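import Literature.MathematicalPhysics.QuantumFieldTheory.Balaban1983to89.Node00.OpsYDelta2Form
import Literature.MathematicalPhysics.QuantumFieldTheory.Balaban1983to89.B9CoReadingCoordsTranspose
import Literature.MathematicalPhysics.QuantumFieldTheory.Balaban1983to89.B9SiteKernelBlockMajorant
import Literature.MathematicalPhysics.QuantumFieldTheory.Balaban1983to89.B9Thm312Whole
import Literature.MathematicalPhysics.QuantumFieldTheory.Balaban1983to89.B9Eq336CurrentBound
import Literature.MathematicalPhysics.QuantumFieldTheory.Balaban1983to89.B9CoReadingCoordsH

/-!
# `Balaban1983to89.B9Delta2FormMajorant` — [B9] (3.136)–(3.137): the SUP MAJORANT of the residual letter `Δ⁽²⁾(U)` OF (3.134) (def-Y's `delta2OfY`, a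
# FUNCTION of [5]'s form `C⁽²⁾`) from TWO displayed letters — [5]'s (149) size∕locality of `C⁽²⁾` and print's `|(H*J)(b)| ≦ O(1)Mα₀(Lʲη)⁻³` — in the
# [4]-(2.51) block currency of the N06 certificate's coordinate models

T. Bałaban, *Propagators for lattice gauge theories in a background field*, Commun. Math. Phys. **99** (1985) 389–434 [`Balaban1985BackgroundPropagators`,
"B9"]; [5] = T. Bałaban, *Averaging operations for lattice gauge theories*, Commun. Math. Phys. **98** (1985) 17–51 [`Balaban1985Averaging`]; [4] = T. Bałaban,
*Propagators and renormalization transformations for lattice gauge theories. II*, Commun. Math. Phys. **96** (1984) 223–250 [`Balaban1984PropagatorsII`].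
statement-level skeleton of published theorems with citation tags; proofs where landed; nothing here is a claim about the Yang–Mills mass gap.

THE PRINT (p. 422 bottom – p. 423 top, read from the page image).  (3.136): *"To find bounds for the operator Δ⁽²⁾ let us write it in the form
Δ⁽²⁾A = Σ_{j=1}^{k} Σ_{b∈Λ_j} (Lʲη)^{d+1} tr (δ∕δA) C_j⁽²⁾(A, b)(H\*J)(b)"*; then: *"From the regularity condition (3.36) and the inequality (3.133) we have the
estimate |(H\*J)(b)| ≦ O(1)Mα₀(Lʲη)⁻³ for b ∈ Λ_j.  The inequality (149) in [5] implies [display] hence |(Δ⁽²⁾A)(b)| ≦ O(1)Mα₀(Lʲη)⁻²|A|, b ∈ Δ(y), y ∈ Λ_j,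
(3.137) and the supremum |A| is taken over several j-blocks surrounding Δ(y)."*  [5] p. 40, (149): the functional derivative of the non-linear averaging term
`C_j(U₀, A)` in a direction `δA` is bounded by `C₃·|A|` times a local block average `Q′_j|δA|` of the variation.

THE POINT (seat n06-w8's LOCATED-(B), cell bus I.31859; WIDTH-209 N06, the `hD2sup ∕ hD2L2` letters of the certificate editions 29–30).  def-Y's
`Node00.OpsYDelta2Form` makes the residual `Δ⁽²⁾(U)` of (3.134) a FUNCTION `delta2OfY 𝔡 i parS parB Gp C U` of the one external letter `C` (= [5]'s polarised
`C⁽²⁾(U; ·, ·)`), with (3.136) the theorem `trPairY_delta2OfY_trAdj`: `⟨A′, Δ⁽²⁾(U)A⟩_τ = 2⟨C(U)(A)(A′), H(U)†J(U)⟩_τ`.  The N06 certificate reads every letter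
through dag-n06-d's κ-fold real COORDINATE MODEL `coordOpK b (Δ⁽²⁾(U))` over the orthonormal trace basis `b = trBasis N` of `M_N(ℂ)` and wants print's (3.137) as a
[4]-(2.51) block majorant `θ·(Lʲη)⁻²·e^{−δd(y,y′)}` of that model (edition 30's `hD2sup`; edition 29's L² letter `hD2L2` then follows by Schur,
`B9PerturbationL2Delta2.blockBd_d2coK_of_sup_symm`).  THIS FILE proves that majorant from the two letters print names, for ANY form letter `C`, ANY `U`, over
ANY [B9] geometry and block maps:
* §0 (private) `norm_apply_le_norm`, `abs_re_trace_le`, `abs_re_trace_mul_le` (`|Re tr(XY)| ≦ N‖X‖‖Y‖` for the L²-operator norm; folklore);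
* §1 `trPairY_deltaY_left`, ★ `τ_mul_delta2OfY_apply` — (3.136) READ AT ONE FINE BOND: `τ(a·(Δ⁽²⁾(U)A)(z)) = 2⟨C(U; A, δ_z ⊗ a), H†J⟩_τ` (def-Y's
  `trPairY_delta2OfY_trAdj` at the test function `δ_z ⊗ a`; any trace-dual fibre);
* §2 ★ `abs_repr_delta2OfY_apply_le` — at the fibre of record `M_N(ℂ)`: every real trace coordinate of `(Δ⁽²⁾(U)A)(z)` is `≦ 2N·‖E_k‖·Σ_c K_C(c)·h(c)`
  whenever `‖C(U; A, δ_z ⊗ a)(c)‖ ≦ K_C(c)‖a‖` and `‖(H†J)(c)‖ ≦ h(c)` (`trBasis_repr_eq_trace` + §0, term by term);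
* §3 the DISPLAYED LETTER ★ `C2FormMaj i σ σI C U κ_C δ_C w_C` ([5] (149) + «several j-blocks surrounding Δ(y)» as a three-point block majorant of the
  polarised form at a test delta: sup in the block-supported argument, weight `w_C` at the coarse bond, exponential locality towards both end blocks;
  `c2FormMaj_zero` = the flat inhabitant), `exp_three_point_le` (triangle bookkeeping), and ★★ `hasMajorant_coordOpK_delta2OfY`: `HasMajorant (σ ∘ fst)
  (r • coordOpK (trBasis N) (Δ⁽²⁾(U))) (r·(2N·b²·κ_C·t·C_T·c_R)·W(y)·e^{−δ₂ d(y,y′)})` from `C2FormMaj`, the current letter `‖(H†J)(c)‖ ≦ t·w_H(σI c)`, the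
  p. 398 scale transfer of the product weight `w_C·w_H ↦ W` at rate `ρ_T` and ONE row sum over the coarse bonds at rate `ρ_R` (`δ₂ + ρ_T + ρ_R ≦ δ_C`) — at the
  N06 record `w_C = (Lʲη)^{+1}`, `w_H = (Lʲη)⁻³`, `W = (Lʲη)⁻²`: print's exponents (the `+1` is what (3.137)'s `−2` and the printed `−3` force through (3.136);
  to be confirmed against [5] (136)∕(149) by the page owner when the letter is inhabited);
* §4 (v1.1, APPEND-ONLY) the `(H\*J)` letter itself from two letters: ★ `abs_repr_trAdjY_apply_le` ∕ `norm_trAdjY_apply_le` (any `ℂ`-linear `H`, any `J`: a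
  two-point kernel letter `‖H(δ_c⊗a)(z)‖ ≦ K_H(z)‖a‖` and `‖J(z)‖ ≦ j(z)` give `‖(H†J)(c)‖ ≦ N·b²·Σ_z K_H(z)j(z)`), `norm_trAdjY_apply_le_blocks` (block form with a
  fibre count `n(y)`), `etaBY_pos`, ★ `norm_JY_le_of_regularAt` (def-Y's `JY` under r06's `RegularAt` family: `‖J(U)(b)‖ ≦ 10⁴(d+1)·C·(len)⁻³`, BY NAME from
  `B9Eq336CurrentBound.norm_J_le_blocks`);
* §5 (v1.2, APPEND-ONLY) `deltaY_real_smul`, ★ `norm_apply_deltaY_le_of_hasMajorantHom` — the H-kernel letter of §4 FROM a [4]-(2.51) two-space majorant of the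
  H-letter's scaled coordinate model `HcoK` (n06-d `B9CoReadingCoordsH`; the certificate's (3.133) currency, `(𝔬 x).Hm U = HcoK … H U`): `HasMajorantHom (σI∘fst) (σ∘fst)
  (HcoK i b B cfg O U) K ⟹ ‖O(U)(δ_c ⊗ a)(z)‖ ≦ K(σ z, σI c)·‖a‖` (diagonal evaluation of the indicator + `norm_apply_liftY_le'` + scaling).
HONEST SCOPE.  Finite-dimensional trace algebra and [4]-(2.51)∕(2.54) bookkeeping with explicit constants; the two letters are HYPOTHESIS SCHEMAS — [5]'s
`C⁽²⁾` is not an object of the tree (def-Y: flat witness only) and the `(H\*J)` line is print's own intermediate estimate (its derivation from (3.36) + (3.133),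
i.e. r06's `B9Eq336CurrentBound.norm_J_le_blocks` + the rows-18∕19 H-letters, is NOT done here); nothing of [B9] or [5] asserted; count-neutral; N06 NOT
discharged; one finite lattice at a time — nothing continuum ∕ ℝ⁴ ∕ OS ∕ mass gap ∕ Clay.  Cell `pub-ymgap` (HUMAN RULING D-0062), Track A node N06 [B9],
seat `pub-ymgap-dag-n06-w8` (g2), 2026-08-28.  NEW file; relatives not restated: n06-l `B9SiteKernelBlockMajorant.hasMajorant_coordOpK_of_kernel` (site
sector, two-point kernel ↦ block majorant — its `norm_assembleK_le ∕ assembleK_eq_zero_of` are used BY NAME), r06 `B9Delta2PiMajorant` (the sup dress of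
Δ⁽²⁾_π over one block-normed space), n06-w8 g0 `B9PerturbationL2Delta2` (the L² side).
-/

noncomputable section

namespace Literature.MathematicalPhysics.QuantumFieldTheory.Balaban1983to89.B9Delta2FormMajorant

open Node00 (TrDualY trDualMatY trDualMatY_τ trPairY trPairY_def trAdjY delta2OfY trPairY_delta2OfY_trAdj JY SiteParY BondParY SiteOpY
  CfgY FBondY IBondY BondOpY deltaY)
open B9Eq3132SectDLetters (HDY)
open B6KLevelCensusIndexV1 (KIdx)
open B9CoReadingCoordsTranspose (TrIdx trBasis trBasis_repr_eq_trace)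
open B9CoReadingCoords (assembleK coordOpK coordOpK_apply)
open B9Thm39ReadingCoords (basisBound39)
open B9SiteKernelBlockMajorant (norm_assembleK_le assembleK_eq_zero_of)
open B6RandomWalk (HasMajorant BlockSupp)
open B9Thm34Ext (toB6)
open scoped Matrix
open scoped Matrix.Norms.L2Operator

/-! ## §0 Trace against the operator norm on `M_N(ℂ)` -/

section Trace

variable {N : ℕ}

/-- an entry is bounded by the L²-operator norm (test against a basis vector). [folklore] -/
private theorem norm_apply_le_norm (A : Matrix (Fin N) (Fin N) ℂ) (a a' : Fin N) : ‖A a a'‖ ≤ ‖A‖ := by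
  have h := Matrix.l2_opNorm_mulVec A (EuclideanSpace.single a' (1 : ℂ))
  have h1 : ‖(EuclideanSpace.single a' (1 : ℂ))‖ = 1 := by simp
  rw [h1, mul_one] at h
  refine le_trans ?_ h
  refine le_trans (le_of_eq ?_) (PiLp.norm_apply_le _ a)
  simp

/-- `|Re tr M| ≤ N·‖M‖` for the L²-operator norm. [folklore] -/
private theorem abs_re_trace_le (M : Matrix (Fin N) (Fin N) ℂ) : |(Matrix.trace M).re| ≤ N * ‖M‖ := by
  rw [Matrix.trace, Complex.re_sum]
  calc |∑ a, (M.diag a).re| ≤ ∑ a, |(M.diag a).re| := Finset.abs_sum_le_sum_abs _ _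
    _ ≤ ∑ a : Fin N, ‖M‖ := Finset.sum_le_sum fun a _ => (Complex.abs_re_le_norm _).trans (norm_apply_le_norm M a a)
    _ = N * ‖M‖ := by simp

/-- `|Re tr(XY)| ≤ N·‖X‖·‖Y‖`. [folklore] -/
private theorem abs_re_trace_mul_le (X Y : Matrix (Fin N) (Fin N) ℂ) : |(Matrix.trace (X * Y)).re| ≤ N * ‖X‖ * ‖Y‖ := by
  calc |(Matrix.trace (X * Y)).re| ≤ N * ‖X * Y‖ := abs_re_trace_le _
    _ ≤ N * (‖X‖ * ‖Y‖) := mul_le_mul_of_nonneg_left (norm_mul_le X Y) (Nat.cast_nonneg N)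
    _ = N * ‖X‖ * ‖Y‖ := by ring

end Trace

/-! ## §1 The coordinate reading of (3.136): the value of `Δ⁽²⁾(U)A` at a fine bond, tested against a matrix -/

section Reading

variable {d ℓ : ℕ} {hd : 1 ≤ d + 1} {hL : Odd (ℓ + 1) ∧ 1 < ℓ + 1} {b₀ b₁ : ℝ}
variable {𝔸 : Type} [NormedRing 𝔸] [NormedAlgebra ℂ 𝔸] [CompleteSpace 𝔸]
variable (𝔡 : TrDualY 𝔸) (i : KIdx d ℓ hd hL b₀ b₁) (parS : SiteParY 𝔸 i) (parB : BondParY 𝔸 i) (Gp : SiteOpY 𝔸 i)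
variable (C : CfgY 𝔸 i → (FBondY i → 𝔸) →ₗ[ℂ] (FBondY i → 𝔸) →ₗ[ℂ] (IBondY i → 𝔸))

omit [CompleteSpace 𝔸] in
/-- the trace pairing against a delta function `δ_z ⊗ a` (def-Y's `deltaY`) on the left is `τ(a·Ψ(z))`.
[cite: Balaban1985BackgroundPropagators, (3.48) p.398 (kernels), bookkeeping] -/
theorem trPairY_deltaY_left {X : Type} [Fintype X] (τ : 𝔸 →ₗ[ℂ] ℂ) (z : X) (a : 𝔸) (Ψ : X → 𝔸) :
    trPairY τ (deltaY z a) Ψ = τ (a * Ψ z) := by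
  classical
  rw [trPairY_def, Finset.sum_eq_single z]
  · simp [deltaY]
  · intro w _ hw; simp [deltaY, hw]
  · intro h; exact absurd (Finset.mem_univ z) h

/-- ★ **(3.136) READ AT ONE FINE BOND**: `τ(a·(Δ⁽²⁾(U)A)(z)) = 2⟨C⁽²⁾(U; A, δ_z ⊗ a), H(U)†J(U)⟩_τ` — print's *"Δ⁽²⁾A = Σ_j Σ_{b∈Λ_j} (Lʲη)^{d+1}
tr (δ∕δA) C_j⁽²⁾(A, b)(H\*J)(b)"* in def-Y's normalisation (`trPairY_delta2OfY_trAdj` at the test function `δ_z ⊗ a`).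
[cite: Balaban1985BackgroundPropagators, (3.136) p.422, (3.134) p.422] -/
theorem τ_mul_delta2OfY_apply (U : CfgY 𝔸 i) (A : FBondY i → 𝔸) (z : FBondY i) (a : 𝔸) :
    𝔡.τ (a * delta2OfY 𝔡 i parS parB Gp C U A z) =
      2 * trPairY 𝔡.τ (C U A (deltaY z a)) (trAdjY 𝔡 (HDY i parS parB Gp U) (JY i U)) := by
  rw [← trPairY_deltaY_left 𝔡.τ z a, trPairY_delta2OfY_trAdj]

end Reading

/-! ## §2 At the fibre of record `M_N(ℂ)`: the coordinates and the norm of `(Δ⁽²⁾(U)A)(z)` from bounds on the two letters of (3.136) -/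

section Fibre

variable {N : ℕ} {d ℓ : ℕ} {hd : 1 ≤ d + 1} {hL : Odd (ℓ + 1) ∧ 1 < ℓ + 1} {b₀ b₁ : ℝ}
variable (i : KIdx d ℓ hd hL b₀ b₁) (parS : SiteParY (Matrix (Fin N) (Fin N) ℂ) i) (parB : BondParY (Matrix (Fin N) (Fin N) ℂ) i)
  (Gp : SiteOpY (Matrix (Fin N) (Fin N) ℂ) i)
  (C : CfgY (Matrix (Fin N) (Fin N) ℂ) i → (FBondY i → Matrix (Fin N) (Fin N) ℂ) →ₗ[ℂ] (FBondY i → Matrix (Fin N) (Fin N) ℂ) →ₗ[ℂ]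
    (IBondY i → Matrix (Fin N) (Fin N) ℂ))

/-- ★ **THE COORDINATES OF `(Δ⁽²⁾(U)A)(z)` FROM THE TWO LETTERS OF (3.136)**: if the polarised form at the test deltas is bounded by `K_C(c)·‖a‖` and
`‖(H†J)(c)‖ ≤ h(c)`, then every real trace coordinate of `(Δ⁽²⁾(U)A)(z)` is `≤ 2N·‖E_k‖·Σ_c K_C(c)h(c)` (trace against operator norm, term by term).
[cite: Balaban1985BackgroundPropagators, (3.136)–(3.137) pp.422–423] -/
theorem abs_repr_delta2OfY_apply_le (U : CfgY (Matrix (Fin N) (Fin N) ℂ) i) (A : FBondY i → Matrix (Fin N) (Fin N) ℂ) (z : FBondY i)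
    {KC h : IBondY i → ℝ} (hKC : ∀ c, 0 ≤ KC c)
    (hC : ∀ (a : Matrix (Fin N) (Fin N) ℂ) (c : IBondY i), ‖C U A (deltaY z a) c‖ ≤ KC c * ‖a‖)
    (hHJ : ∀ c : IBondY i, ‖trAdjY (trDualMatY N) (HDY i parS parB Gp U) (JY i U) c‖ ≤ h c) (k : TrIdx N) :
    |(trBasis N).repr (delta2OfY (trDualMatY N) i parS parB Gp C U A z) k| ≤ 2 * N * ‖trBasis N k‖ * ∑ c, KC c * h c := by
  rw [trBasis_repr_eq_trace]
  have hτ : Matrix.trace ((trBasis N k)ᴴ * delta2OfY (trDualMatY N) i parS parB Gp C U A z) =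
      2 * trPairY (trDualMatY N).τ (C U A (deltaY z (trBasis N k)ᴴ)) (trAdjY (trDualMatY N) (HDY i parS parB Gp U) (JY i U)) := by
    rw [← trDualMatY_τ]; exact τ_mul_delta2OfY_apply (trDualMatY N) i parS parB Gp C U A z _
  rw [hτ, trPairY_def]
  simp only [trDualMatY_τ]
  set X : IBondY i → Matrix (Fin N) (Fin N) ℂ := C U A (deltaY z (trBasis N k)ᴴ) with hX
  set Y : IBondY i → Matrix (Fin N) (Fin N) ℂ := trAdjY (trDualMatY N) (HDY i parS parB Gp U) (JY i U) with hY
  have h2 : ((2 : ℂ) * ∑ x, Matrix.trace (X x * Y x)).re = 2 * ∑ x, (Matrix.trace (X x * Y x)).re := by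
    rw [show (2 : ℂ) = ((2 : ℝ) : ℂ) by norm_num, Complex.re_ofReal_mul, Complex.re_sum]
  rw [h2, abs_mul, abs_two]
  have hN : (0 : ℝ) ≤ N := Nat.cast_nonneg N
  have hterm : ∀ x, |(Matrix.trace (X x * Y x)).re| ≤ N * (KC x * ‖(trBasis N k)ᴴ‖) * h x := fun x =>
    (abs_re_trace_mul_le _ _).trans
      (mul_le_mul (mul_le_mul_of_nonneg_left (hC _ x) hN) (hHJ x) (norm_nonneg _)
        (mul_nonneg hN (mul_nonneg (hKC x) (norm_nonneg _))))
  calc 2 * |∑ x, (Matrix.trace (X x * Y x)).re| ≤ 2 * ∑ x, |(Matrix.trace (X x * Y x)).re| :=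
        mul_le_mul_of_nonneg_left (Finset.abs_sum_le_sum_abs _ _) two_pos.le
    _ ≤ 2 * ∑ x, N * (KC x * ‖(trBasis N k)ᴴ‖) * h x := mul_le_mul_of_nonneg_left (Finset.sum_le_sum fun x _ => hterm x) two_pos.le
    _ = 2 * N * ‖trBasis N k‖ * ∑ c, KC c * h c := by
        rw [Matrix.l2_opNorm_conjTranspose, Finset.mul_sum, Finset.mul_sum]
        exact Finset.sum_congr rfl fun x _ => by ring

end Fibre

/-! ## §3 The displayed letter for [5]'s form `C⁽²⁾` and the [4]-(2.51) block majorant of `Δ⁽²⁾(U)`'s coordinate model ((3.137)'s shape) -/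

section Schema

variable {d ℓ : ℕ} {hd : 1 ≤ d + 1} {hL : Odd (ℓ + 1) ∧ 1 < ℓ + 1} {b₀ b₁ : ℝ}
variable {𝔸 : Type} [NormedRing 𝔸] [NormedAlgebra ℂ 𝔸] [CompleteSpace 𝔸]
variable (i : KIdx d ℓ hd hL b₀ b₁) {g : B9.Geometry}

/-- **THE DISPLAYED SIZE-AND-LOCALITY LETTER FOR [5]'s POLARISED SECOND-ORDER FORM `C⁽²⁾(U; A, A′)`** — [5] (149) (*"|⟨(δ∕δA)C_j(U₀, A), δA⟩| ≦ C₃…|A|·Q′_j|δA|"*: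
the functional derivative of the non-linear averaging term is bounded by the SUP of `A` times a LOCAL block average of the variation) and [B9] p. 423 after (3.137)
(*"the supremum |A| is taken over several j-blocks surrounding Δ(y)"*), read as a THREE-POINT BLOCK MAJORANT in the [4]-(2.51) currency: for `A` supported in
the fine block of `y′` with `‖A‖ ≦ B` there, a test delta `δ_z ⊗ a` at a fine bond `z` and a coarse bond `c`,
`‖C⁽²⁾(U; A, δ_z ⊗ a)(c)‖ ≦ κ_C · w_C(c) · e^{−δ_C d(c, y(z))} · e^{−δ_C d(c, y′)} · B · ‖a‖` (block maps `σ` on fine bonds, `σI` on coarse bonds; the two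
exponentials encode «local in both arguments», finite range being the case `κ_C ↦ κ_C e^{2δ_C r}`; `w_C` is the scale weight, print's net `(Lʲη)^{+1}` at the
N06 record).  A LETTER (hypothesis schema) about def-Y's parameter `C2LettersY.form`; its inhabitant is [5]'s construction, NOT in the tree.
[cite: Balaban1985Averaging, (149) p.40; Balaban1985BackgroundPropagators, (3.136)–(3.137) pp.422–423; Balaban1984PropagatorsII, (2.51) p.232] -/
def C2FormMaj (σ : FBondY i → g.Site) (σI : IBondY i → g.Site)
    (C : CfgY 𝔸 i → (FBondY i → 𝔸) →ₗ[ℂ] (FBondY i → 𝔸) →ₗ[ℂ] (IBondY i → 𝔸)) (U : CfgY 𝔸 i) (κC δC : ℝ) (wC : g.Site → ℝ) : Prop :=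
  ∀ (y' : g.Site) (A : FBondY i → 𝔸) (B : ℝ), 0 ≤ B → (∀ w, σ w = y' → ‖A w‖ ≤ B) → (∀ w, σ w ≠ y' → A w = 0) →
    ∀ (z : FBondY i) (a : 𝔸) (c : IBondY i),
      ‖C U A (deltaY z a) c‖ ≤ κC * wC (σI c) * Real.exp (-(δC * g.dist (σI c) (σ z))) * Real.exp (-(δC * g.dist (σI c) y')) * B * ‖a‖

/-- the flat form `C⁽²⁾ = 0` inhabits the letter with `κ_C = 0` (nonvacuity). [cite: Balaban1985BackgroundPropagators, (3.134) p.422, bookkeeping] -/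
theorem c2FormMaj_zero (σ : FBondY i → g.Site) (σI : IBondY i → g.Site) (U : CfgY 𝔸 i) (δC : ℝ) (wC : g.Site → ℝ) :
    C2FormMaj i σ σI (fun _ => 0) U 0 δC wC := by
  intro y' A B _ _ _ z a c
  simp

end Schema

section Majorant

open B9Thm312Whole (GeoOK)
open B9CoReadingCoords (XBK)

variable {N : ℕ} {d ℓ : ℕ} {hd : 1 ≤ d + 1} {hL : Odd (ℓ + 1) ∧ 1 < ℓ + 1} {b₀ b₁ : ℝ}
variable (i : KIdx d ℓ hd hL b₀ b₁) (parS : SiteParY (Matrix (Fin N) (Fin N) ℂ) i) (parB : BondParY (Matrix (Fin N) (Fin N) ℂ) i)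
  (Gp : SiteOpY (Matrix (Fin N) (Fin N) ℂ) i)
  (C : CfgY (Matrix (Fin N) (Fin N) ℂ) i → (FBondY i → Matrix (Fin N) (Fin N) ℂ) →ₗ[ℂ] (FBondY i → Matrix (Fin N) (Fin N) ℂ) →ₗ[ℂ]
    (IBondY i → Matrix (Fin N) (Fin N) ℂ))
variable {g : B9.Geometry} [Fintype g.Site] {R₀ : ℝ} {H₀ : Prop}

omit [Fintype g.Site] in
/-- the three-point exponential bookkeeping: two decays from `c` split into the decay between the end blocks (triangle inequality), a transfer factor and a
row-sum factor at `c`. [cite: Balaban1984PropagatorsII, (2.54) p.233, (2.60)–(2.61) p.234, bookkeeping] -/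
theorem exp_three_point_le (hG : GeoOK g) {δC δ₂ ρT ρR : ℝ} (hδ₂ : 0 ≤ δ₂) (hρT : 0 ≤ ρT) (hρR : 0 ≤ ρR) (hδC : δ₂ + ρT + ρR ≤ δC)
    (y y' c : g.Site) :
    Real.exp (-(δC * g.dist c y)) * Real.exp (-(δC * g.dist c y')) ≤
      Real.exp (-(δ₂ * g.dist y y')) * Real.exp (-(ρT * g.dist y c)) * Real.exp (-(ρR * g.dist y c)) := by
  rw [← Real.exp_add, ← Real.exp_add, ← Real.exp_add, hG.symm c y]
  apply Real.exp_le_exp.mpr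
  have htri := hG.tri y c y'
  have hd1 := hG.dnn y c
  have hd2 := hG.dnn c y'
  have hA : 0 ≤ (δC - (δ₂ + ρT + ρR)) * (g.dist y c + g.dist c y') := mul_nonneg (sub_nonneg.mpr hδC) (add_nonneg hd1 hd2)
  have hB : 0 ≤ δ₂ * (g.dist y c + g.dist c y' - g.dist y y') := mul_nonneg hδ₂ (sub_nonneg.mpr htri)
  have hC' : 0 ≤ (ρT + ρR) * g.dist c y' := mul_nonneg (add_nonneg hρT hρR) hd2
  nlinarith [hA, hB, hC']

/-- ★★ **THE [4]-(2.51) BLOCK MAJORANT OF `Δ⁽²⁾(U)`'s COORDINATE MODEL — (3.137)'s SHAPE — FROM THE TWO LETTERS OF (3.136)**: under the form letter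
`C2FormMaj` (weight `w_C`, rate `δ_C`), print's current letter `‖(H†J)(c)‖ ≦ t·w_H(c)` (p. 422: *"From the regularity condition (3.36) and the inequality (3.133) we
have the estimate |(H\*J)(b)| ≦ O(1)Mα₀(Lʲη)⁻³"*), the p. 398 scale transfer of the product weight `w_C·w_H ↦ W` at the rate `ρ_T` and a row sum over the coarse
bonds at the rate `ρ_R` (`δ₂ + ρ_T + ρ_R ≦ δ_C`), the scaled model `r • coordOpK` of `Δ⁽²⁾(U)` over the trace basis has the block majorant
`r·(2N·b²·κ_C·t·C_T·c_R)·W(y)·e^{−δ₂d(y,y′)}` w.r.t. the fine block map — print's *"|(Δ⁽²⁾A)(b)| ≦ O(1)Mα₀(Lʲη)⁻²|A|, b ∈ Δ(y)"* with every constant explicit.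
[cite: Balaban1985BackgroundPropagators, (3.136)–(3.137) pp.422–423, p.398 remark after (3.47); Balaban1985Averaging, (149) p.40; Balaban1984PropagatorsII, (2.51) p.232, (2.54), (2.61) pp.233–234] -/
theorem hasMajorant_coordOpK_delta2OfY (hG : GeoOK g) (σ : FBondY i → g.Site) (σI : IBondY i → g.Site)
    (U : CfgY (Matrix (Fin N) (Fin N) ℂ) i) {κC δC tHJ ρT CT ρR cR δ₂ r : ℝ} {wC wH W : g.Site → ℝ}
    (hκC : 0 ≤ κC) (hwC : ∀ y, 0 ≤ wC y) (htHJ : 0 ≤ tHJ) (hwH : ∀ y, 0 ≤ wH y) (hCT : 0 ≤ CT) (hW : ∀ y, 0 ≤ W y) (hr : 0 ≤ r)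
    (hδ₂ : 0 ≤ δ₂) (hρT : 0 ≤ ρT) (hρR : 0 ≤ ρR) (hδC : δ₂ + ρT + ρR ≤ δC)
    (hC2 : C2FormMaj i σ σI C U κC δC wC)
    (hHJ : ∀ c : IBondY i, ‖trAdjY (trDualMatY N) (HDY i parS parB Gp U) (JY i U) c‖ ≤ tHJ * wH (σI c))
    (hT : ∀ (y : g.Site) (c : IBondY i), Real.exp (-(ρT * g.dist y (σI c))) * (wC (σI c) * wH (σI c)) ≤ CT * W y)
    (hR : ∀ y : g.Site, ∑ c : IBondY i, Real.exp (-(ρR * g.dist y (σI c))) ≤ cR) :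
    HasMajorant (g := toB6 g R₀ H₀) (fun p : XBK (TrIdx N) i => σ p.1)
      (r • coordOpK (trBasis N) (fun _ : Fin (d + 1) => (delta2OfY (trDualMatY N) i parS parB Gp C U).restrictScalars ℝ))
      (fun (y y' : g.Site) => r * (2 * N * basisBound39 (trBasis N) ^ 2 * κC * tHJ * CT * cR) * W y * Real.exp (-(δ₂ * g.dist y y'))) := by
  intro y' μ Bd hμ p
  obtain ⟨z, ν, k, k'⟩ := p
  rw [LinearMap.smul_apply, Pi.smul_apply, coordOpK_apply, smul_eq_mul, abs_mul, abs_of_nonneg hr]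
  simp only [LinearMap.restrictScalars_apply]
  -- the assembled slice: supported in the block of `y′`, bounded by `b·Bd`
  set A : FBondY i → Matrix (Fin N) (Fin N) ℂ := assembleK (trBasis N) ν k' μ with hA
  set bB : ℝ := basisBound39 (trBasis N) with hbB
  have hbB0 : 0 ≤ bB := Finset.sum_nonneg fun c _ => norm_nonneg _
  have hAoff : ∀ w, σ w ≠ y' → A w = 0 := fun w hw => assembleK_eq_zero_of (trBasis N) ν k' μ w fun a => hμ.off (w, ν, a, k') hw
  have hAbd : ∀ w, σ w = y' → ‖A w‖ ≤ bB * Bd := fun w hw => norm_assembleK_le (trBasis N) ν k' μ w fun a => hμ.bound (w, ν, a, k') hw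
  -- the two letters at this slice
  set KC : IBondY i → ℝ := fun c =>
    κC * wC (σI c) * Real.exp (-(δC * g.dist (σI c) (σ z))) * Real.exp (-(δC * g.dist (σI c) y')) * (bB * Bd) with hKC
  have hKC0 : ∀ c, 0 ≤ KC c := fun c =>
    mul_nonneg (mul_nonneg (mul_nonneg (mul_nonneg hκC (hwC _)) (Real.exp_nonneg _)) (Real.exp_nonneg _)) (mul_nonneg hbB0 hμ.nonneg)
  have hCz : ∀ (a : Matrix (Fin N) (Fin N) ℂ) (c : IBondY i), ‖C U A (deltaY z a) c‖ ≤ KC c * ‖a‖ := fun a c =>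
    hC2 y' A (bB * Bd) (mul_nonneg hbB0 hμ.nonneg) hAbd hAoff z a c
  have hrepr := abs_repr_delta2OfY_apply_le i parS parB Gp C U A z hKC0 hCz (fun c => hHJ c) k
  -- ‖E_k‖ ≤ b
  have hbk : ‖trBasis N k‖ ≤ bB := by
    rw [hbB, basisBound39]
    exact Finset.single_le_sum (f := fun c => ‖trBasis N c‖) (fun c _ => norm_nonneg _) (Finset.mem_univ k)
  -- the sum over the coarse bonds
  have hsum : ∑ c, KC c * (tHJ * wH (σI c)) ≤ κC * bB * Bd * tHJ * CT * cR * W (σ z) * Real.exp (-(δ₂ * g.dist (σ z) y')) := by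
    have hterm : ∀ c, KC c * (tHJ * wH (σI c)) ≤
        κC * bB * Bd * tHJ * (CT * W (σ z)) * Real.exp (-(δ₂ * g.dist (σ z) y')) * Real.exp (-(ρR * g.dist (σ z) (σI c))) := by
      intro c
      have h3 := exp_three_point_le hG hδ₂ hρT hρR hδC (σ z) y' (σI c)
      have hww : 0 ≤ wC (σI c) * wH (σI c) := mul_nonneg (hwC _) (hwH _)
      have hT' := hT (σ z) c
      have hpre : 0 ≤ κC * bB * Bd * tHJ := mul_nonneg (mul_nonneg (mul_nonneg hκC hbB0) hμ.nonneg) htHJ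
      calc KC c * (tHJ * wH (σI c))
          = κC * bB * Bd * tHJ * (wC (σI c) * wH (σI c)) *
              (Real.exp (-(δC * g.dist (σI c) (σ z))) * Real.exp (-(δC * g.dist (σI c) y'))) := by rw [hKC]; ring
        _ ≤ κC * bB * Bd * tHJ * (wC (σI c) * wH (σI c)) *
              (Real.exp (-(δ₂ * g.dist (σ z) y')) * Real.exp (-(ρT * g.dist (σ z) (σI c))) * Real.exp (-(ρR * g.dist (σ z) (σI c)))) :=
            mul_le_mul_of_nonneg_left h3 (mul_nonneg hpre hww)
        _ = κC * bB * Bd * tHJ * (Real.exp (-(ρT * g.dist (σ z) (σI c))) * (wC (σI c) * wH (σI c))) *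
              Real.exp (-(δ₂ * g.dist (σ z) y')) * Real.exp (-(ρR * g.dist (σ z) (σI c))) := by ring
        _ ≤ κC * bB * Bd * tHJ * (CT * W (σ z)) * Real.exp (-(δ₂ * g.dist (σ z) y')) * Real.exp (-(ρR * g.dist (σ z) (σI c))) :=
            mul_le_mul_of_nonneg_right (mul_le_mul_of_nonneg_right (mul_le_mul_of_nonneg_left hT' hpre) (Real.exp_nonneg _))
              (Real.exp_nonneg _)
    have hCW : 0 ≤ CT * W (σ z) := mul_nonneg hCT (hW _)
    calc ∑ c, KC c * (tHJ * wH (σI c))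
        ≤ ∑ c, κC * bB * Bd * tHJ * (CT * W (σ z)) * Real.exp (-(δ₂ * g.dist (σ z) y')) * Real.exp (-(ρR * g.dist (σ z) (σI c))) :=
          Finset.sum_le_sum fun c _ => hterm c
      _ = κC * bB * Bd * tHJ * (CT * W (σ z)) * Real.exp (-(δ₂ * g.dist (σ z) y')) * ∑ c, Real.exp (-(ρR * g.dist (σ z) (σI c))) := by
          rw [Finset.mul_sum]
      _ ≤ κC * bB * Bd * tHJ * (CT * W (σ z)) * Real.exp (-(δ₂ * g.dist (σ z) y')) * cR :=
          mul_le_mul_of_nonneg_left (hR (σ z))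
            (mul_nonneg (mul_nonneg (mul_nonneg (mul_nonneg (mul_nonneg hκC hbB0) hμ.nonneg) htHJ) hCW) (Real.exp_nonneg _))
      _ = κC * bB * Bd * tHJ * CT * cR * W (σ z) * Real.exp (-(δ₂ * g.dist (σ z) y')) := by ring
  have hN : (0 : ℝ) ≤ N := Nat.cast_nonneg N
  calc r * |(trBasis N).repr (delta2OfY (trDualMatY N) i parS parB Gp C U A z) k|
      ≤ r * (2 * N * ‖trBasis N k‖ * ∑ c, KC c * (tHJ * wH (σI c))) := mul_le_mul_of_nonneg_left hrepr hr
    _ ≤ r * (2 * N * bB * (κC * bB * Bd * tHJ * CT * cR * W (σ z) * Real.exp (-(δ₂ * g.dist (σ z) y')))) := by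
        refine mul_le_mul_of_nonneg_left ?_ hr
        exact mul_le_mul (mul_le_mul_of_nonneg_left hbk (mul_nonneg two_pos.le hN)) hsum
          (Finset.sum_nonneg fun c _ => mul_nonneg (hKC0 c) (mul_nonneg htHJ (hwH _))) (mul_nonneg (mul_nonneg two_pos.le hN) hbB0)
    _ = r * (2 * N * basisBound39 (trBasis N) ^ 2 * κC * tHJ * CT * cR) * W (σ z) * Real.exp (-(δ₂ * g.dist (σ z) y')) * Bd := by
        rw [hbB]; ring

end Majorant

/-! ## §4 (v1.1, APPEND-ONLY) The current letter `‖(H†J)(c)‖` ITSELF from two letters: a two-point kernel letter for `H` ((3.133)'s shape) and the pointwise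
current bound ((3.36) ⟹ `|J| ≦ O(1)Mα₀(Lʲη)⁻³`, r06's `B9Eq336CurrentBound.norm_J_le_blocks` under `RegularAt`) — print p. 422: *"From the regularity condition (3.36)
and the inequality (3.133) we have the estimate |(H\*J)(b)| ≦ O(1)Mα₀(Lʲη)⁻³ for b ∈ Λ_j"* -/

section Transpose

variable {N : ℕ} {X Y : Type} [Fintype X] [Fintype Y]

/-- ★ **THE COORDINATES OF `(H†J)(c)` FROM A KERNEL LETTER FOR `H` AND A POINTWISE LETTER FOR `J`**: for any `ℂ`-linear `H : (Y → M_N) →ₗ (X → M_N)` with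
`‖H(δ_c ⊗ a)(z)‖ ≦ K_H(z)‖a‖` and any `J` with `‖J(z)‖ ≦ j(z)`, every real trace coordinate of def-Y's transpose `(H†J)(c)` (`trAdjY`: `⟨Φ, H†Ψ⟩_τ = ⟨HΦ, Ψ⟩_τ`)
is `≦ N·‖E_k‖·Σ_z K_H(z)j(z)`. [cite: Balaban1985BackgroundPropagators, (3.136) p.422 («(H\*J)(b)»), (3.133) p.422, p.422 («we have the estimate |(H\*J)(b)| ≦ …»)] -/
theorem abs_repr_trAdjY_apply_le (H : (Y → Matrix (Fin N) (Fin N) ℂ) →ₗ[ℂ] (X → Matrix (Fin N) (Fin N) ℂ)) (J : X → Matrix (Fin N) (Fin N) ℂ) (c : Y)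
    {KH j : X → ℝ} (hKH : ∀ z, 0 ≤ KH z) (hH : ∀ (a : Matrix (Fin N) (Fin N) ℂ) (z : X), ‖H (deltaY c a) z‖ ≤ KH z * ‖a‖)
    (hJ : ∀ z, ‖J z‖ ≤ j z) (k : TrIdx N) :
    |(trBasis N).repr (trAdjY (trDualMatY N) H J c) k| ≤ N * ‖trBasis N k‖ * ∑ z, KH z * j z := by
  rw [trBasis_repr_eq_trace]
  have hτ : Matrix.trace ((trBasis N k)ᴴ * trAdjY (trDualMatY N) H J c) = trPairY (trDualMatY N).τ (H (deltaY c (trBasis N k)ᴴ)) J := by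
    rw [← trDualMatY_τ, ← trPairY_deltaY_left (trDualMatY N).τ c _ (trAdjY (trDualMatY N) H J), Node00.trPairY_trAdjY]
  rw [hτ, trPairY_def]
  simp only [trDualMatY_τ]
  rw [Complex.re_sum]
  have hN : (0 : ℝ) ≤ N := Nat.cast_nonneg N
  have hterm : ∀ z, |(Matrix.trace (H (deltaY c (trBasis N k)ᴴ) z * J z)).re| ≤ N * (KH z * ‖(trBasis N k)ᴴ‖) * j z := fun z =>
    (abs_re_trace_mul_le _ _).trans
      (mul_le_mul (mul_le_mul_of_nonneg_left (hH _ z) hN) (hJ z) (norm_nonneg _) (mul_nonneg hN (mul_nonneg (hKH z) (norm_nonneg _))))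
  calc |∑ z, (Matrix.trace (H (deltaY c (trBasis N k)ᴴ) z * J z)).re| ≤ ∑ z, |(Matrix.trace (H (deltaY c (trBasis N k)ᴴ) z * J z)).re| :=
        Finset.abs_sum_le_sum_abs _ _
    _ ≤ ∑ z, N * (KH z * ‖(trBasis N k)ᴴ‖) * j z := Finset.sum_le_sum fun z _ => hterm z
    _ = N * ‖trBasis N k‖ * ∑ z, KH z * j z := by
        rw [Matrix.l2_opNorm_conjTranspose, Finset.mul_sum]
        exact Finset.sum_congr rfl fun z _ => by ring

/-- ★ **THE NORM OF `(H†J)(c)`** under the same two letters: `‖(H†J)(c)‖ ≦ N·b²·Σ_z K_H(z)j(z)` (`b = basisBound39 (trBasis N)`).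
[cite: Balaban1985BackgroundPropagators, p.422 («|(H\*J)(b)| ≦ O(1)Mα₀(Lʲη)⁻³»), (3.133) p.422] -/
theorem norm_trAdjY_apply_le (H : (Y → Matrix (Fin N) (Fin N) ℂ) →ₗ[ℂ] (X → Matrix (Fin N) (Fin N) ℂ)) (J : X → Matrix (Fin N) (Fin N) ℂ) (c : Y)
    {KH j : X → ℝ} (hKH : ∀ z, 0 ≤ KH z) (hH : ∀ (a : Matrix (Fin N) (Fin N) ℂ) (z : X), ‖H (deltaY c a) z‖ ≤ KH z * ‖a‖)
    (hJ : ∀ z, ‖J z‖ ≤ j z) :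
    ‖trAdjY (trDualMatY N) H J c‖ ≤ N * basisBound39 (trBasis N) ^ 2 * ∑ z, KH z * j z := by
  have hbB0 : 0 ≤ basisBound39 (trBasis N) := Finset.sum_nonneg fun c _ => norm_nonneg _
  have hS : 0 ≤ ∑ z, KH z * j z := Finset.sum_nonneg fun z _ => mul_nonneg (hKH z) ((norm_nonneg _).trans (hJ z))
  have hbk : ∀ k, ‖trBasis N k‖ ≤ basisBound39 (trBasis N) := fun k =>
    Finset.single_le_sum (f := fun c => ‖trBasis N c‖) (fun c _ => norm_nonneg _) (Finset.mem_univ k)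
  have h := B9CoReadingCoords.norm_le_basisBound_mul (trBasis N) (trAdjY (trDualMatY N) H J c)
    (M := N * basisBound39 (trBasis N) * ∑ z, KH z * j z) fun k =>
      (abs_repr_trAdjY_apply_le H J c hKH hH hJ k).trans
        (mul_le_mul_of_nonneg_right (mul_le_mul_of_nonneg_left (hbk k) (Nat.cast_nonneg N)) hS)
  calc ‖trAdjY (trDualMatY N) H J c‖ ≤ basisBound39 (trBasis N) * (N * basisBound39 (trBasis N) * ∑ z, KH z * j z) := h
    _ = N * basisBound39 (trBasis N) ^ 2 * ∑ z, KH z * j z := by ring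

/-- ★ **BLOCK FORM**: if the kernel letter factors through a fine block map `σ` (`K_H(z) = B_H·k_H(σ z)`, the (3.133) shape at fixed `c`), the current letter does too
(`j(z) = t_J·w_J(σ z)`, the (3.36) shape) and the fibres of `σ` have at most `n(y)` elements, then `‖(H†J)(c)‖ ≦ N·b²·B_H·t_J·Σ_y n(y)·k_H(y)·w_J(y)` — the
remaining sum over the blocks is print's «O(1)» geometric sum (scale transfer + (2.61) at the record).
[cite: Balaban1985BackgroundPropagators, p.422 («|(H\*J)(b)| ≦ O(1)Mα₀(Lʲη)⁻³»), (3.133) p.422, (3.36) p.396; Balaban1984PropagatorsII, (2.61) p.234] -/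
theorem norm_trAdjY_apply_le_blocks {B : Type} [Fintype B] [DecidableEq B] (σ : X → B)
    (H : (Y → Matrix (Fin N) (Fin N) ℂ) →ₗ[ℂ] (X → Matrix (Fin N) (Fin N) ℂ)) (J : X → Matrix (Fin N) (Fin N) ℂ) (c : Y)
    {BH tJ : ℝ} {kH wJ n : B → ℝ} (hBH : 0 ≤ BH) (htJ : 0 ≤ tJ) (hkH : ∀ y, 0 ≤ kH y) (hwJ : ∀ y, 0 ≤ wJ y)
    (hH : ∀ (a : Matrix (Fin N) (Fin N) ℂ) (z : X), ‖H (deltaY c a) z‖ ≤ BH * kH (σ z) * ‖a‖) (hJ : ∀ z, ‖J z‖ ≤ tJ * wJ (σ z))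
    (hn : ∀ y : B, ((Finset.univ.filter fun z => σ z = y).card : ℝ) ≤ n y) :
    ‖trAdjY (trDualMatY N) H J c‖ ≤ N * basisBound39 (trBasis N) ^ 2 * (BH * tJ) * ∑ y, n y * kH y * wJ y := by
  have h := norm_trAdjY_apply_le H J c (KH := fun z => BH * kH (σ z)) (j := fun z => tJ * wJ (σ z))
    (fun z => mul_nonneg hBH (hkH _)) hH hJ
  have hfib : ∑ z, BH * kH (σ z) * (tJ * wJ (σ z)) ≤ (BH * tJ) * ∑ y, n y * kH y * wJ y := by
    rw [← Finset.sum_fiberwise_of_maps_to (g := σ) (t := Finset.univ) (fun z _ => Finset.mem_univ (σ z)), Finset.mul_sum]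
    refine Finset.sum_le_sum fun y _ => ?_
    have hc : ∑ z ∈ Finset.univ.filter (fun z => σ z = y), BH * kH (σ z) * (tJ * wJ (σ z)) =
        ((Finset.univ.filter fun z => σ z = y).card : ℝ) * (BH * kH y * (tJ * wJ y)) := by
      rw [Finset.sum_congr rfl fun z hz => by rw [(Finset.mem_filter.1 hz).2], Finset.sum_const, nsmul_eq_mul]
    rw [hc]
    calc ((Finset.univ.filter fun z => σ z = y).card : ℝ) * (BH * kH y * (tJ * wJ y)) ≤ n y * (BH * kH y * (tJ * wJ y)) :=
          mul_le_mul_of_nonneg_right (hn y) (mul_nonneg (mul_nonneg hBH (hkH y)) (mul_nonneg htJ (hwJ y)))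
      _ = BH * tJ * (n y * kH y * wJ y) := by ring
  have hpre : 0 ≤ (N : ℝ) * basisBound39 (trBasis N) ^ 2 := mul_nonneg (Nat.cast_nonneg N) (sq_nonneg _)
  calc ‖trAdjY (trDualMatY N) H J c‖ ≤ N * basisBound39 (trBasis N) ^ 2 * ∑ z, BH * kH (σ z) * (tJ * wJ (σ z)) := h
    _ ≤ N * basisBound39 (trBasis N) ^ 2 * ((BH * tJ) * ∑ y, n y * kH y * wJ y) := mul_le_mul_of_nonneg_left hfib hpre
    _ = N * basisBound39 (trBasis N) ^ 2 * (BH * tJ) * ∑ y, n y * kH y * wJ y := by ring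

end Transpose

section CurrentJ

open B9Eq336CurrentBound (RegularAt norm_J_le_blocks)
open B9BackgroundsKLevelV1 (shiftsV1)
open B6GlobalChartV1 (PV)

variable {d ℓ : ℕ} {hd : 1 ≤ d + 1} {hL : Odd (ℓ + 1) ∧ 1 < ℓ + 1} {b₀ b₁ : ℝ}
variable {𝔸 : Type} [NormedRing 𝔸] [NormedAlgebra ℂ 𝔸] [CompleteSpace 𝔸]
variable (i : KIdx d ℓ hd hL b₀ b₁)

/-- `η = |c_f|⁻¹ > 0` at the index. [cite: Balaban1985BackgroundPropagators, p.389 (T_η), bookkeeping] -/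
theorem etaBY_pos : 0 < Node00.etaBY i := inv_pos.mpr (abs_pos.mpr i.hcf)

/-- ★ **THE CURRENT LETTER FOR def-Y's `J(U)` FROM (3.36), via r06**: if the background is REGULAR (r06's bond-local datum `RegularAt` of (3.35)–(3.36), constant `C =
O(1)Mα₀ ≦ 1`) at every bond at the scale `len(σ x) ≧ η` of the block of its source, then `‖J(U)(b)‖ ≦ 10⁴(d+1)·C·(len(σ b.src)³)⁻¹` — r06's
`B9Eq336CurrentBound.norm_J_le_blocks` at NODE 00's torus shifts (`shiftsV1_comm`) and `η = |c_f|⁻¹`.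
[cite: Balaban1985BackgroundPropagators, (3.36) p.396, p.422 («From the regularity condition (3.36) …»), (3.11) p.392] -/
theorem norm_JY_le_of_regularAt {B : Type} (σ : Site (PV d ℓ i.m i.K hd hL) 0 → B) (len : B → ℝ)
    (hlen : ∀ y, Node00.etaBY i ≤ len y) {C : ℝ} (hC0 : 0 ≤ C) (hC1 : C ≤ 1) (U : CfgY 𝔸 i)
    (hreg : ∀ μ x, RegularAt (shiftsV1 (PV d ℓ i.m i.K hd hL)) U (Node00.etaBY i) C (len (σ x)) μ x) (b : FBondY i) :
    ‖JY i U b‖ ≤ 10 ^ 4 * (d + 1) * C * (len (σ b.src) ^ 3)⁻¹ := by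
  have h := norm_J_le_blocks (shiftsV1 (PV d ℓ i.m i.K hd hL)) (Node00.shiftsV1_comm i) (etaBY_pos i) hC0 hC1 U σ len hlen hreg b.dir b.src
  rw [Node00.JY_apply]
  simpa [Fintype.card_fin] using h

end CurrentJ

/-! ## §5 (v1.2, APPEND-ONLY) The H-kernel letter of §4 FROM a [4]-(2.51) two-space majorant of the H-letter's coordinate model `HcoK` (the certificate's
currency for (3.133): `(𝔬 x).Hm U = HcoK … H U`) — the bridge back from coordinates to the genuine operator -/

section KernelFromModel

open B9CoReadingCoords (XBK evDiagK abs_evDiagK_le evDiagK_eq_zero_of)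
open B9CoReadingCoordsH (XHK HcoK indY liftY_indY abs_indY_le indY_of_ne coordOpKH_evDiagK norm_apply_liftY_le')
open B9Thm39ReadingCoords (cR39 cR39_nonneg)
open B6RandomWalkHom (HasMajorantHom)
open Node00 (liftY)

variable {d ℓ : ℕ} {hd : 1 ≤ d + 1} {hL : Odd (ℓ + 1) ∧ 1 < ℓ + 1} {b₀ b₁ : ℝ}
variable {𝔸 : Type} [NormedRing 𝔸] [NormedAlgebra ℂ 𝔸] [CompleteSpace 𝔸] [FiniteDimensional ℝ 𝔸]
variable {κ : Type} [Fintype κ] [DecidableEq κ]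
variable (i : KIdx d ℓ hd hL b₀ b₁) (b : Module.Basis κ ℝ 𝔸) (B : B9.Backgrounds) (cfg : B.Cfg → CfgY 𝔸 i)
  (O : CfgY 𝔸 i → (IBondY i → 𝔸) →ₗ[ℂ] (FBondY i → 𝔸))
variable {g : B9.Geometry} [Fintype g.Site] {R₀ : ℝ} {H₀ : Prop}

omit [CompleteSpace 𝔸] [FiniteDimensional ℝ 𝔸] in
/-- `δ_c ⊗ (r·E) = r·(δ_c ⊗ E)` for a real scalar. [cite: Balaban1985BackgroundPropagators, (3.48) p.398 (kernels), bookkeeping] -/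
theorem deltaY_real_smul {X : Type} (c : X) (r : ℝ) (E : 𝔸) : (deltaY c ((r : ℂ) • E) : X → 𝔸) = (r : ℂ) • deltaY c E := by
  funext z
  simp only [deltaY, Pi.smul_apply]
  split_ifs <;> simp

/-- ★ **THE H-KERNEL LETTER FROM THE MODEL's TWO-SPACE MAJORANT**: if the H-letter's scaled coordinate model `HcoK i b B cfg O U₁` has the [4]-(2.51) majorant `K`
from the coarse carrier (block map `σI ∘ fst`) to the bond carrier (block map `σ ∘ fst`) and `cR39 b > 0`, then the genuine letter has the two-point kernel bound
`‖O(U)(δ_c ⊗ a)(z)‖ ≦ K(σ z, σI c)·‖a‖` — the input shape of `norm_trAdjY_apply_le`. (The model on the diagonal evaluation of the indicator of `c` reads the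
coordinates of `O(U)(δ_c ⊗ b_{k′})(z)` (`coordOpKH_evDiagK`), which dominate `‖O(U)(δ_c ⊗ E)(z)‖` for `‖E‖ ≦ 1` up to `cR39 b` (`norm_apply_liftY_le'`); then scale.)
[cite: Balaban1985BackgroundPropagators, (3.133) p.422, (3.126) p.420; Balaban1984PropagatorsII, (2.51) p.232] -/
theorem norm_apply_deltaY_le_of_hasMajorantHom (σ : FBondY i → g.Site) (σI : IBondY i → g.Site) (U₁ : B.Cfg) (hc : 0 < cR39 b)
    {K : g.Site → g.Site → ℝ}
    (h : HasMajorantHom (g := toB6 g R₀ H₀) (fun p : XHK κ i => σI p.1) (fun p : XBK κ i => σ p.1) (HcoK i b B cfg O U₁) K)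
    (a : 𝔸) (z : FBondY i) (c : IBondY i) : ‖O (cfg U₁) (deltaY c a) z‖ ≤ K (σ z) (σI c) * ‖a‖ := by
  -- the model at the diagonal evaluation of the indicator of `c`
  have hsupp : B6RandomWalk.BlockSupp (g := toB6 g R₀ H₀) (fun p : XHK κ i => σI p.1) (evDiagK (indY i c)) (σI c) 1 := by
    refine ⟨zero_le_one, fun p _ => (abs_evDiagK_le _ p).trans (abs_indY_le i c p.1), fun p hp => evDiagK_eq_zero_of (indY_of_ne i ?_)⟩
    intro hpc; exact hp (by rw [hpc])
  have hcoord : ∀ (ν : Fin (d + 1)) (k k' : κ), |b.repr (((O (cfg U₁)).restrictScalars ℝ) (liftY (indY i c) (b k')) z) k| ≤ K (σ z) (σI c) / cR39 b := by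
    intro ν k k'
    have hp := h (σI c) (evDiagK (indY i c)) 1 hsupp (z, ν, k, k')
    rw [HcoK, LinearMap.smul_apply, Pi.smul_apply, coordOpKH_evDiagK, smul_eq_mul, abs_mul, abs_of_nonneg (cR39_nonneg b), mul_one] at hp
    rw [le_div_iff₀ hc, mul_comm]
    exact hp
  -- unit directions, then scale
  have hunit : ∀ E : 𝔸, ‖E‖ ≤ 1 → ‖O (cfg U₁) (deltaY c E) z‖ ≤ K (σ z) (σI c) := by
    intro E hE
    have hν : Fin (d + 1) := ⟨0, hd⟩
    have h1 := norm_apply_liftY_le' b ((O (cfg U₁)).restrictScalars ℝ) (indY i c) hE z (hcoord hν · ·)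
    rw [liftY_indY, LinearMap.restrictScalars_apply, mul_div_cancel₀ _ hc.ne'] at h1
    exact h1
  by_cases ha : a = 0
  · subst ha
    have h0 : (deltaY c (0 : 𝔸) : IBondY i → 𝔸) = 0 := by funext w; simp [deltaY]
    rw [h0, map_zero, Pi.zero_apply, norm_zero]
    simp
  · have hapos : 0 < ‖a‖ := norm_pos_iff.mpr ha
    have hE : ‖((‖a‖⁻¹ : ℝ) : ℂ) • a‖ ≤ 1 := by
      rw [norm_smul, Complex.norm_real, Real.norm_of_nonneg (inv_nonneg.mpr hapos.le), inv_mul_cancel₀ hapos.ne']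
    have hdec : (deltaY c a : IBondY i → 𝔸) = ((‖a‖ : ℝ) : ℂ) • deltaY c ((((‖a‖⁻¹ : ℝ) : ℂ)) • a) := by
      rw [← deltaY_real_smul, smul_smul, ← Complex.ofReal_mul, mul_inv_cancel₀ hapos.ne', Complex.ofReal_one, one_smul]
    rw [hdec, map_smul, Pi.smul_apply, norm_smul, Complex.norm_real, Real.norm_of_nonneg hapos.le, mul_comm]
    exact mul_le_mul_of_nonneg_right (hunit _ hE) hapos.le

end KernelFromModel

end Literature.MathematicalPhysics.QuantumFieldTheory.Balaban1983to89.B9Delta2FormMajorant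

end
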